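import Summits.HodgeConjecture.HodgeConjecture.Theses.CurveNetMordellWeil
import Literature.AlgebraicGeometry.Motives.BaseChange
import Literature.AlgebraicGeometry.HodgeTheory.AlgebraicClassesPullback

/-!
# Line `qbar-envelope-42` — crux stmt-HodgeConjecture-2784 `CurveNetMordellWeil.VerticalSupportFourfolds`

Crux-strategist line (WALL-BREAKER pass, 2026-08-17), second registered skeleton: the ARITHMETIC
decomposition of HC(2,2) for fourfolds (the crux, by the landed sandwich p106042) — the lens
TRANSFER toward the arithmetic sibling named in the payload ("the Tate conjecture over finite fields
as the arithmetic sibling"): move every `(X⁴, c)` into a variety DEFINED OVER A NUMBER FIELD, where a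
Hodge class has incarnations absent at transcendental parameters (algebraic de Rham class over a
finite extension, crystalline Frobenii, ℓ-adic Galois representations; Hodge ⇒ absolute Hodge ⇒
Tate), and prove HC there. This is Voisin's reduction (Voisin 2007, *Hodge loci and absolute Hodge
classes*, Prop. 1.7 / Thm. 0.6; Charles–Schnell Thm. 11.3.17–11.3.19), i.e. route `QbarEnvelope`
(items stmt-HodgeConjecture-1069/1070/1071) SLICED to degree-4 classes:

* `stub_envelopeFourfolds` (E42, the `(4,2)` slice of `QbarEnvelope.Envelope`): every rational
  `(2,2)`-class on a smooth projective complex fourfold is `ι^* c'` for a `ℂ`-morphism `ι : X ⟶ W`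
  into a smooth projective `W` definable over a number field and a rational `(2,2)`-class `c'` on
  `W` (`W` = `ℚ̄`-compactification of the family over the Hodge-locus component of `(X, c)`, after
  finite base change; global invariant cycles + semisimplicity). Implied by HC(2,2)(X) (spread the
  cycle over `ℚ̄`); equivalent in substance to "the Hodge-locus components of `(2,2)`-classes of
  fourfolds are defined over `ℚ̄`" (⇐ `c` weakly absolute Hodge; known for abelian-type fourfolds
  by Deligne/André, for weakly non-factor positive-dimensional components by
  Klingler–Otwinowska–Urbanik Thm. 1.12).
* `stub_hodgeTwoTwoOverNumberFields` (HCQ̄², the degree-4 slice of `QbarEnvelope.HCOverNumberFields`):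
  HC for rational `(2,2)`-classes on smooth projective complex varieties of EVERY dimension that are
  definable over a number field. Incomparable with the crux (weaker field of definition, all
  dimensions); for `ℚ̄`-ABELIAN varieties of dimension ≤ 5 it is a theorem (Moonen–Zarhin +
  Markman 2025); arithmetic tools: Tate classes, `p`-adic variational Hodge (Bloch–Esnault–Kerz),
  CM/Weil anchors.
* `stub_pullbackAlgebraic` = the Literature NAMED FACT `fulton1998_map_mem_algebraicClasses`
  (Fulton Cor. 19.2 (b) / Voisin II Prop. 9.21 (i) on the tree's carrier; unproved in the tree;
  the route item `QbarEnvelope.PullbackAlgebraic`, stmt-1071, is its binder-reordering) — literature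
  debt, worker-attackable (moving lemma + cycle class with supports), shared with routes
  `QbarEnvelope` and `PeriodDeficiency`.

`VerticalSupportFourfolds_of : E42 → HCQ̄² → fulton1998_map_mem_algebraicClasses → crux`:
`c = ι^* c'`, `c'` algebraic on `W` by HCQ̄², `ι^* c'` algebraic by the fact, `le_sup_left`.
Disproof used: no `Disproof.lean` exists for this crux; rationality of `c` is load-bearing in E42
(`c = ι^* c'` with `c'` rational forces it), honouring the would-be `_false_without_IsRationalClass`
(TypeOnly false at the very general sextic, IdeatorFive §1).
-/

noncomputable section

open CategoryTheory AlgebraicGeometry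
open Literature Literature.AlgebraicGeometry Literature.AlgebraicGeometry.Motives
  Literature.AlgebraicGeometry.HodgeTheory

namespace Summit.HodgeConjecture.HodgeConjecture.Cruxes.VerticalSupportFourfolds.QbarEnvelope42

/-- **Stub 1 (E42) — the `ℚ̄`-ENVELOPE for `(2,2)`-classes on fourfolds** (the `(n,p) = (4,2)` slice
of `QbarEnvelope.Envelope`, stmt-HodgeConjecture-1069; Voisin 2007 Prop. 1.7, Charles–Schnell
Thm. 11.3.19). OPEN (sub-crux): forced by HC(2,2)(X); fails iff some Hodge-locus component of
`(2,2)`-classes in a `ℚ`-family of fourfolds is not defined over `ℚ̄` (then HC fails too).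
[cite: Voisin2007HodgeLoci, Prop. 1.7 and Thm. 0.6] [cite: CharlesSchnell2014Notes, Thm. 11.3.19] -/
theorem stub_envelopeFourfolds :
    ∀ ⦃X : SchemeOver ℂ⦄, IsSmoothProjective 4 X → ∀ c : complexBetti X (2 * 2),
      IsRationalClass c → IsOfHodgeType 4 X (2 * 2) 2 2 c →
        ∃ (m : ℕ) (W : SchemeOver ℂ) (ι : X ⟶ W) (c' : complexBetti W (2 * 2)),
          IsSmoothProjective m W ∧
          (∃ (K : Type) (_ : Field K) (_ : NumberField K) (σ : K →+* ℂ) (W₀ : SchemeOver K),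
            Nonempty (W ≅ (baseChangeHom σ).obj W₀)) ∧
          IsRationalClass c' ∧ IsOfHodgeType m W (2 * 2) 2 2 c' ∧ complexBetti.map ι (2 * 2) c' = c := by
  sorry

/-- **Stub 2 (HCQ̄²) — the Hodge conjecture in CODIMENSION 2 for varieties definable over a number
field** (every dimension; the degree-4 slice of `QbarEnvelope.HCOverNumberFields`, stmt-1070).
OPEN (sub-crux); incomparable with the crux. [cite: Deligne1982HodgeCycles, §2]
[cite: CharlesSchnell2014Notes, Cor. 11.3.16] -/
theorem stub_hodgeTwoTwoOverNumberFields :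
    ∀ ⦃m : ℕ⦄ ⦃W : SchemeOver ℂ⦄, IsSmoothProjective m W →
      (∃ (K : Type) (_ : Field K) (_ : NumberField K) (σ : K →+* ℂ) (W₀ : SchemeOver K),
        Nonempty (W ≅ (baseChangeHom σ).obj W₀)) →
        ∀ c' : complexBetti W (2 * 2), IsRationalClass c' → IsOfHodgeType m W (2 * 2) 2 2 c' →
          c' ∈ algebraicClasses W 2 := by
  sorry

/-- **Stub 3 — pull-back of algebraic classes along morphisms of smooth projective varieties**
(Fulton 1998 Cor. 19.2 (b); Voisin II Prop. 9.21 (i)): literally the Literature NAMED FACT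
`fulton1998_map_mem_algebraicClasses` (unproved in the tree; `.pullbackAlgebraic` is the route item
`QbarEnvelope.PullbackAlgebraic`). Literature debt: discharge it in `Literature/` (moving lemma +
cycle class with supports) or reduce it. [cite: Fulton1998, §19.2 Cor. 19.2 (b)] -/
theorem stub_pullbackAlgebraic : fulton1998_map_mem_algebraicClasses := by
  sorry

/-- **Composition** — the three stubs imply the crux BY NAME: for a rational `(2,2)`-class `c` on the
fourfold `X`, E42 gives `c = ι^* c'` with `W` definable over a number field; HCQ̄² makes `c'`
algebraic on `W`; the pull-back fact makes `ι^* c'` algebraic on `X`; the algebraic classes are the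
first summand of the crux's right-hand side. Sorry-free (sorries only inside the `stub_*`).
[cite: Voisin2007HodgeLoci, Thm. 0.6] -/
theorem VerticalSupportFourfolds_of
    (hE : ∀ ⦃X : SchemeOver ℂ⦄, IsSmoothProjective 4 X → ∀ c : complexBetti X (2 * 2),
      IsRationalClass c → IsOfHodgeType 4 X (2 * 2) 2 2 c →
        ∃ (m : ℕ) (W : SchemeOver ℂ) (ι : X ⟶ W) (c' : complexBetti W (2 * 2)),
          IsSmoothProjective m W ∧
          (∃ (K : Type) (_ : Field K) (_ : NumberField K) (σ : K →+* ℂ) (W₀ : SchemeOver K),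
            Nonempty (W ≅ (baseChangeHom σ).obj W₀)) ∧
          IsRationalClass c' ∧ IsOfHodgeType m W (2 * 2) 2 2 c' ∧ complexBetti.map ι (2 * 2) c' = c)
    (hQ : ∀ ⦃m : ℕ⦄ ⦃W : SchemeOver ℂ⦄, IsSmoothProjective m W →
      (∃ (K : Type) (_ : Field K) (_ : NumberField K) (σ : K →+* ℂ) (W₀ : SchemeOver K),
        Nonempty (W ≅ (baseChangeHom σ).obj W₀)) →
        ∀ c' : complexBetti W (2 * 2), IsRationalClass c' → IsOfHodgeType m W (2 * 2) 2 2 c' →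
          c' ∈ algebraicClasses W 2)
    (hP : fulton1998_map_mem_algebraicClasses) :
    Summit.HodgeConjecture.HodgeConjecture.Theses.CurveNetMordellWeil.VerticalSupportFourfolds := by
  intro X pr hX _
  refine le_trans (Submodule.span_le.2 ?_) le_sup_left
  rintro c ⟨hc, hpp⟩
  obtain ⟨m, W, ι, c', hW, hWK, hc', hpp', rfl⟩ := hE hX c hc hpp
  exact hP.pullbackAlgebraic hX hW ι 2 c' (hQ hW hWK c' hc' hpp')

/-- The crux from the three stubs (the line's claim, modulo the sorried sub-cruxes and the fact).
[cite: Voisin2007HodgeLoci, Thm. 0.6] -/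
theorem verticalSupportFourfolds_of_stubs :
    Summit.HodgeConjecture.HodgeConjecture.Theses.CurveNetMordellWeil.VerticalSupportFourfolds :=
  VerticalSupportFourfolds_of stub_envelopeFourfolds stub_hodgeTwoTwoOverNumberFields
    stub_pullbackAlgebraic

end Summit.HodgeConjecture.HodgeConjecture.Cruxes.VerticalSupportFourfolds.QbarEnvelope42

end
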